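import Summits.PneNP.PneNP.Theorems.ChebyshevTracialDesignHomogeneousRounding
import HarnessLib

/-!
# Cell pnp-psdrank, route `ChebyshevTracialDesign`, brick 70a: Bernoulli product weights — MARGINALS and the MEASURE form of homogeneous rounding

Tools for transferring SET statements about the tight graph to WEIGHTS (used by brick 70b `…TightMassWeighted`): the derandomised
probabilistic method of brick 64 (`…HomogeneousRounding`), extended by
* §1 Bernoulli product weights over an arbitrary index type: master identity `bern_sum_mul_prod` (`= Finset.prod_add`), `bern_sum` (= 1),
  `bern_nonneg`, `bern_sum_notMem` (`P(i ∉ A) = 1 − x_i`), the MARGINAL identity `bern_sum_sum_eq` (`E Σ_{i∈A} f i = Σ x_i f_i`), and the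
  lower tail `bern_sum_small_le_half` (`P(2|A| < Σx) ≤ 1/2` once `Σ x ≥ 10`);
* §2 `sum_bernoulli_good_ge_quarter` — brick 64 in MEASURE form: under its hypotheses (finite ground type, `ℱ ⊆ 𝒜`, `0 ≤ y ≤ 1`
  `(𝒜,τ)`-homogeneous on `ℱ`, heavy nonempty stars) the roundings `𝒢 ⊆ ℱ` that are `(𝒜,4τ)`-homogeneous with `y(ℱ) ≤ 2|𝒢|` carry
  Bernoulli mass `≥ 1/4` (expected number of bad events `≤ 3/4`).
[cite: AlonSpencer2016, Appendix A.1 (Chernoff bounds) and Ch. 3 (the probabilistic method)] [cite: KupavskiiZakharov2022, §2]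
Stature: support/instrument (kernel theorems, no defs). WHAT THIS IS NOT: no measure theory; nothing on psd rank, no P-vs-NP content.
Supports stmt-PneNP-19878.
-/

set_option linter.dupNamespace false -- `Summit.PneNP.PneNP.…`: summit = sub-problem (D-0017)

noncomputable section

namespace Summit.PneNP.PneNP.Theorems.ChebyshevTracialDesignBernoulliMarginals

open Finset Literature.Combinatorics.SetFamily
open Summit.PneNP.PneNP.Theorems.ChebyshevTracialDesignHomogeneousRounding

/-! ### §1 Bernoulli product weights over an arbitrary index type -/

section Bernoulli

variable {ι : Type*} [DecidableEq ι]

/-- Master identity: `Σ_{A ⊆ S} (Π_{A} x · Π_{S∖A} (1−x)) · Π_{A} c = Π_{S} (1 + x(c − 1))`.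
[cite: AlonSpencer2016, Appendix A.1] -/
theorem bern_sum_mul_prod (S : Finset ι) (x c : ι → ℝ) :
    ∑ A ∈ S.powerset, ((∏ i ∈ A, x i) * ∏ i ∈ S \ A, (1 - x i)) * ∏ i ∈ A, c i = ∏ i ∈ S, (1 + x i * (c i - 1)) := by
  have h : ∏ i ∈ S, (1 + x i * (c i - 1)) = ∏ i ∈ S, (x i * c i + (1 - x i)) := prod_congr rfl fun i _ => by ring
  rw [h, prod_add]
  refine sum_congr rfl fun A _ => ?_
  rw [prod_mul_distrib]
  ring

/-- The Bernoulli weights sum to `1`. [cite: AlonSpencer2016, Appendix A.1] -/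
theorem bern_sum (S : Finset ι) (x : ι → ℝ) : ∑ A ∈ S.powerset, (∏ i ∈ A, x i) * ∏ i ∈ S \ A, (1 - x i) = 1 := by
  have h := bern_sum_mul_prod S x fun _ => 1
  simp only [prod_const_one, mul_one, sub_self, mul_zero, add_zero] at h
  exact h

/-- The Bernoulli weights are nonnegative for `0 ≤ x ≤ 1`. [cite: AlonSpencer2016, Appendix A.1] -/
theorem bern_nonneg {S A : Finset ι} {x : ι → ℝ} (hx : ∀ i, 0 ≤ x i ∧ x i ≤ 1) :
    0 ≤ (∏ i ∈ A, x i) * ∏ i ∈ S \ A, (1 - x i) :=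
  mul_nonneg (prod_nonneg fun i _ => (hx i).1) (prod_nonneg fun i _ => sub_nonneg.2 (hx i).2)

/-- The probability of EXCLUDING a given element: `Σ_{A ⊆ S, i ∉ A} P(A) = 1 − x i` (`i ∈ S`). [cite: AlonSpencer2016, Appendix A.1] -/
theorem bern_sum_notMem (S : Finset ι) (x : ι → ℝ) {i : ι} (hi : i ∈ S) :
    ∑ A ∈ S.powerset, ((∏ j ∈ A, x j) * ∏ j ∈ S \ A, (1 - x j)) * (if i ∈ A then 0 else 1) = 1 - x i := by
  have h := bern_sum_mul_prod S x fun j => if j = i then 0 else 1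
  have hprod : ∀ A : Finset ι, ∏ j ∈ A, (if j = i then (0 : ℝ) else 1) = if i ∈ A then 0 else 1 := by
    intro A
    by_cases hA : i ∈ A
    · rw [if_pos hA]; exact prod_eq_zero hA (by simp)
    · rw [if_neg hA]; exact prod_eq_one fun j hj => by rw [if_neg]; rintro rfl; exact hA hj
  simp_rw [hprod] at h
  rw [h, ← prod_erase_mul S _ hi]
  simp only [if_true, zero_sub, mul_neg, mul_one]
  rw [prod_eq_one fun j hj => by rw [if_neg (ne_of_mem_erase hj)]; ring]
  ring

/-- **Marginals**: `Σ_{A ⊆ S} P(A) · Σ_{i ∈ A} f i = Σ_{i ∈ S} x_i f_i`. [cite: AlonSpencer2016, Appendix A.1] -/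
theorem bern_sum_sum_eq (S : Finset ι) (x f : ι → ℝ) :
    ∑ A ∈ S.powerset, ((∏ j ∈ A, x j) * ∏ j ∈ S \ A, (1 - x j)) * ∑ i ∈ A, f i = ∑ i ∈ S, x i * f i := by
  have hin : ∀ A ∈ S.powerset, ∑ i ∈ A, f i = ∑ i ∈ S, (if i ∈ A then f i else 0) := by
    intro A hA
    rw [← sum_filter, filter_mem_eq_inter, inter_eq_right.2 (mem_powerset.1 hA)]
  rw [sum_congr rfl fun A hA => by rw [hin A hA], ]
  simp_rw [mul_sum]
  rw [sum_comm]
  refine sum_congr rfl fun i hi => ?_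
  have h1 : ∑ A ∈ S.powerset, ((∏ j ∈ A, x j) * ∏ j ∈ S \ A, (1 - x j)) * (if i ∈ A then f i else 0) =
      f i * ∑ A ∈ S.powerset, ((∏ j ∈ A, x j) * ∏ j ∈ S \ A, (1 - x j)) * (1 - (if i ∈ A then 0 else 1)) := by
    rw [mul_sum]
    refine sum_congr rfl fun A _ => ?_
    split_ifs <;> ring
  rw [h1]
  have h2 : ∑ A ∈ S.powerset, ((∏ j ∈ A, x j) * ∏ j ∈ S \ A, (1 - x j)) * (1 - (if i ∈ A then (0 : ℝ) else 1)) = x i := by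
    have e : ∀ A : Finset ι, ((∏ j ∈ A, x j) * ∏ j ∈ S \ A, (1 - x j)) * (1 - (if i ∈ A then (0 : ℝ) else 1)) =
        ((∏ j ∈ A, x j) * ∏ j ∈ S \ A, (1 - x j)) - ((∏ j ∈ A, x j) * ∏ j ∈ S \ A, (1 - x j)) * (if i ∈ A then 0 else 1) :=
      fun A => by ring
    simp_rw [e]
    rw [sum_sub_distrib, bern_sum, bern_sum_notMem S x hi]
    ring
  rw [h2, mul_comm]

/-- **Lower tail**: `P(2|A| < Σ_S x) ≤ 1/2` once `Σ_S x ≥ 10` (`0 ≤ x ≤ 1`). [cite: AlonSpencer2016, Appendix A.1 (Chernoff)] -/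
theorem bern_sum_small_le_half (S : Finset ι) {x : ι → ℝ} (hx : ∀ i, 0 ≤ x i ∧ x i ≤ 1) (hm : (10 : ℝ) ≤ ∑ i ∈ S, x i) :
    ∑ A ∈ S.powerset, ((∏ j ∈ A, x j) * ∏ j ∈ S \ A, (1 - x j)) * (if 2 * (#A : ℝ) < ∑ i ∈ S, x i then (1 : ℝ) else 0) ≤ 1 / 2 := by
  set m : ℝ := ∑ i ∈ S, x i with hm_def
  -- the moment `E (1/2)^{|A|} ≤ exp(−m/2)`
  have hmom : ∑ A ∈ S.powerset, ((∏ j ∈ A, x j) * ∏ j ∈ S \ A, (1 - x j)) * (1 / 2 : ℝ) ^ #A ≤ Real.exp (-(m / 2)) := by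
    have key := bern_sum_mul_prod S x fun _ => (1 / 2 : ℝ)
    simp only [prod_const] at key
    rw [key, show -(m / 2) = ∑ i ∈ S, x i * ((1 / 2 : ℝ) - 1) by rw [hm_def, ← sum_mul]; ring, Real.exp_sum]
    refine prod_le_prod (fun i _ => ?_) fun i _ => ?_
    · have := (hx i).2; nlinarith [(hx i).1]
    · have := Real.add_one_le_exp (x i * (1 / 2 - 1)); linarith
  calc ∑ A ∈ S.powerset, ((∏ j ∈ A, x j) * ∏ j ∈ S \ A, (1 - x j)) * (if 2 * (#A : ℝ) < m then (1 : ℝ) else 0)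
      ≤ ∑ A ∈ S.powerset, ((∏ j ∈ A, x j) * ∏ j ∈ S \ A, (1 - x j)) * ((1 / 2 : ℝ) ^ #A * Real.exp (Real.log 2 * (m / 2))) :=
        sum_le_sum fun A _ => mul_le_mul_of_nonneg_left (indicator_lt_le_half_pow m #A) (bern_nonneg hx)
    _ = (∑ A ∈ S.powerset, ((∏ j ∈ A, x j) * ∏ j ∈ S \ A, (1 - x j)) * (1 / 2 : ℝ) ^ #A) * Real.exp (Real.log 2 * (m / 2)) := by
        rw [sum_mul]; exact sum_congr rfl fun A _ => by ring
    _ ≤ Real.exp (-(m / 2)) * Real.exp (Real.log 2 * (m / 2)) := mul_le_mul_of_nonneg_right hmom (Real.exp_pos _).le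
    _ = Real.exp (-((1 - Real.log 2) * (m / 2))) := by rw [← Real.exp_add]; ring_nf
    _ ≤ Real.exp (-((1 - Real.log 2) * 5)) := Real.exp_le_exp.2 (by have hl := Real.log_two_lt_d9; nlinarith)
    _ ≤ 1 / 2 := exp_neg_five_mul_le_half

end Bernoulli

/-! ### §2 Brick 64 in measure form: the good roundings carry mass `≥ 1/4` -/

open scoped Classical in
/-- **Homogeneous rounding, measure form.** Under the hypotheses of `…HomogeneousRounding.exists_homogeneous_subfamily` (finite ground type,
`ℱ ⊆ 𝒜`, `0 ≤ y ≤ 1` `(𝒜,τ)`-homogeneous on `ℱ`, heavy nonempty stars), the Bernoulli mass of the subfamilies `𝒢 ⊆ ℱ` that are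
`(𝒜, 4τ)`-homogeneous with `y(ℱ) ≤ 2|𝒢|` is at least `1/4`. [cite: AlonSpencer2016, Appendix A.1 (Chernoff bounds) and Ch. 3] -/
theorem sum_bernoulli_good_ge_quarter {α : Type*} [DecidableEq α] [Fintype α] {τ : ℝ} (hτ : 0 ≤ τ) {𝒜 ℱ : Finset (Finset α)}
    (hℱ𝒜 : ℱ ⊆ 𝒜) {y : Finset α → ℝ} (hy : ∀ A, 0 ≤ y A ∧ y A ≤ 1) (hhom : IsRelHomogeneousW τ 𝒜 y ℱ)
    (hΛ : ∀ S : Finset α, (supersets 𝒜 S).Nonempty →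
      (2 * Fintype.card α + 10 : ℝ) * #𝒜 ≤ τ ^ #S * #(supersets 𝒜 S) * wmass y ℱ) :
    1 / 4 ≤ ∑ 𝒢 ∈ ℱ.powerset, ((∏ A ∈ 𝒢, y A) * ∏ A ∈ ℱ \ 𝒢, (1 - y A)) *
      (if IsRelHomogeneous (4 * τ) 𝒜 𝒢 ∧ wmass y ℱ ≤ 2 * #𝒢 then (1 : ℝ) else 0) := by
  classical
  rcases 𝒜.eq_empty_or_nonempty with h𝒜 | h𝒜
  · subst h𝒜
    have hℱ : ℱ = ∅ := subset_empty.1 hℱ𝒜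
    subst hℱ
    rw [powerset_empty, sum_singleton, if_pos ⟨isRelHomogeneous_empty _ _, by simp⟩]
    norm_num
  have hApos : (0 : ℝ) < #𝒜 := by exact_mod_cast h𝒜.card_pos
  set m : ℝ := wmass y ℱ with hm_def
  set K : ℕ := Fintype.card α with hK_def
  have hm : (2 * K + 10 : ℝ) ≤ m := by
    have h := hΛ ∅ (by rwa [supersets_emptyset])
    rw [supersets_emptyset, card_empty, pow_zero, one_mul] at h
    nlinarith
  set lam : Finset α → ℝ := fun S => τ ^ #S * #(supersets 𝒜 S) * m / #𝒜 with hlam_def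
  have hlam_mass : ∀ S, wmass y (supersets ℱ S) ≤ lam S := fun S => by
    rw [hlam_def]; dsimp only; rw [le_div_iff₀ hApos]; exact hhom S
  have hlam_big : ∀ S, (supersets 𝒜 S).Nonempty → (2 * K + 10 : ℝ) ≤ lam S := fun S hS => by
    rw [hlam_def]; dsimp only; rw [le_div_iff₀ hApos]; exact hΛ S hS
  set P : Finset (Finset α) → ℝ := fun 𝒢 => (∏ A ∈ 𝒢, y A) * ∏ A ∈ ℱ \ 𝒢, (1 - y A) with hP_def
  set 𝒮 : Finset (Finset α) := univ.filter fun S => (supersets 𝒜 S).Nonempty with h𝒮_def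
  set bad : Finset (Finset α) → ℝ := fun 𝒢 =>
    (if 2 * (#𝒢 : ℝ) < m then (1 : ℝ) else 0) +
      ∑ S ∈ 𝒮, (if 2 * lam S < #(supersets 𝒢 S) then (1 : ℝ) else 0) with hbad_def
  have hP0 : ∀ 𝒢, 0 ≤ P 𝒢 := fun 𝒢 => bernoulli_nonneg hy
  have hP1 : ∑ 𝒢 ∈ ℱ.powerset, P 𝒢 = 1 := sum_powerset_bernoulli ℱ y
  -- (1) lower tail of `|𝒢|`
  have h1 : ∑ 𝒢 ∈ ℱ.powerset, P 𝒢 * (if 2 * (#𝒢 : ℝ) < m then (1 : ℝ) else 0) ≤ 1 / 2 := by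
    calc ∑ 𝒢 ∈ ℱ.powerset, P 𝒢 * (if 2 * (#𝒢 : ℝ) < m then (1 : ℝ) else 0)
        ≤ ∑ 𝒢 ∈ ℱ.powerset, P 𝒢 * ((1 / 2 : ℝ) ^ #𝒢 * Real.exp (Real.log 2 * (m / 2))) :=
          sum_le_sum fun 𝒢 _ => mul_le_mul_of_nonneg_left (indicator_lt_le_half_pow m #𝒢) (hP0 𝒢)
      _ = (∑ 𝒢 ∈ ℱ.powerset, P 𝒢 * (1 / 2 : ℝ) ^ #𝒢) * Real.exp (Real.log 2 * (m / 2)) := by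
          rw [sum_mul]; exact sum_congr rfl fun 𝒢 _ => by ring
      _ ≤ Real.exp (-(m / 2)) * Real.exp (Real.log 2 * (m / 2)) :=
          mul_le_mul_of_nonneg_right (sum_powerset_bernoulli_half_pow_le ℱ hy) (Real.exp_pos _).le
      _ = Real.exp (-((1 - Real.log 2) * (m / 2))) := by rw [← Real.exp_add]; ring_nf
      _ ≤ Real.exp (-((1 - Real.log 2) * 5)) := Real.exp_le_exp.2 (by have hl := Real.log_two_lt_d9; nlinarith)
      _ ≤ 1 / 2 := exp_neg_five_mul_le_half
  -- (2) upper tail of each star count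
  have h2 : ∀ S ∈ 𝒮, ∑ 𝒢 ∈ ℱ.powerset, P 𝒢 * (if 2 * lam S < #(supersets 𝒢 S) then (1 : ℝ) else 0) ≤
      Real.exp ((2 * K + 10) * (1 - 2 * Real.log 2)) := by
    intro S hS
    have hS' : (supersets 𝒜 S).Nonempty := (mem_filter.1 hS).2
    calc ∑ 𝒢 ∈ ℱ.powerset, P 𝒢 * (if 2 * lam S < #(supersets 𝒢 S) then (1 : ℝ) else 0)
        ≤ ∑ 𝒢 ∈ ℱ.powerset, P 𝒢 * ((2 : ℝ) ^ #(supersets 𝒢 S) * Real.exp (-(Real.log 2 * (2 * lam S)))) :=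
          sum_le_sum fun 𝒢 _ => mul_le_mul_of_nonneg_left (indicator_lt_le_two_pow (lam S) _) (hP0 𝒢)
      _ = (∑ 𝒢 ∈ ℱ.powerset, P 𝒢 * (2 : ℝ) ^ #(supersets 𝒢 S)) * Real.exp (-(Real.log 2 * (2 * lam S))) := by
          rw [sum_mul]; exact sum_congr rfl fun 𝒢 _ => by ring
      _ ≤ Real.exp (wmass y (supersets ℱ S)) * Real.exp (-(Real.log 2 * (2 * lam S))) :=
          mul_le_mul_of_nonneg_right (sum_powerset_bernoulli_two_pow_le ℱ hy S) (Real.exp_pos _).le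
      _ ≤ Real.exp (lam S) * Real.exp (-(Real.log 2 * (2 * lam S))) :=
          mul_le_mul_of_nonneg_right (Real.exp_le_exp.2 (hlam_mass S)) (Real.exp_pos _).le
      _ = Real.exp (lam S * (1 - 2 * Real.log 2)) := by rw [← Real.exp_add]; ring_nf
      _ ≤ Real.exp ((2 * K + 10) * (1 - 2 * Real.log 2)) := Real.exp_le_exp.2 (by
          have hl := Real.log_two_gt_d9
          have hneg : 1 - 2 * Real.log 2 ≤ 0 := by linarith
          exact mul_le_mul_of_nonpos_right (hlam_big S hS') hneg)
  have h𝒮 : (#𝒮 : ℝ) ≤ (2 : ℝ) ^ K := by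
    have : #𝒮 ≤ #(univ : Finset (Finset α)) := card_le_card (filter_subset _ _)
    rw [card_univ, Fintype.card_finset] at this
    exact_mod_cast this
  -- (3) the expected number of bad events is `≤ 3/4`
  have hbadsum : ∑ 𝒢 ∈ ℱ.powerset, P 𝒢 * bad 𝒢 ≤ 3 / 4 := by
    have hsplit : ∑ 𝒢 ∈ ℱ.powerset, P 𝒢 * bad 𝒢 =
        ∑ 𝒢 ∈ ℱ.powerset, P 𝒢 * (if 2 * (#𝒢 : ℝ) < m then (1 : ℝ) else 0) +
          ∑ S ∈ 𝒮, ∑ 𝒢 ∈ ℱ.powerset, P 𝒢 * (if 2 * lam S < #(supersets 𝒢 S) then (1 : ℝ) else 0) := by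
      rw [sum_comm, ← sum_add_distrib]
      exact sum_congr rfl fun 𝒢 _ => by rw [hbad_def]; dsimp only; rw [mul_add, mul_sum]
    rw [hsplit]
    have h3 : ∑ S ∈ 𝒮, ∑ 𝒢 ∈ ℱ.powerset, P 𝒢 * (if 2 * lam S < #(supersets 𝒢 S) then (1 : ℝ) else 0) ≤ 1 / 4 :=
      calc ∑ S ∈ 𝒮, ∑ 𝒢 ∈ ℱ.powerset, P 𝒢 * (if 2 * lam S < #(supersets 𝒢 S) then (1 : ℝ) else 0)
          ≤ ∑ _S ∈ 𝒮, Real.exp ((2 * K + 10) * (1 - 2 * Real.log 2)) := sum_le_sum h2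
        _ = #𝒮 * Real.exp ((2 * K + 10) * (1 - 2 * Real.log 2)) := by rw [sum_const, nsmul_eq_mul]
        _ ≤ (2 : ℝ) ^ K * Real.exp ((2 * K + 10) * (1 - 2 * Real.log 2)) :=
            mul_le_mul_of_nonneg_right h𝒮 (Real.exp_pos _).le
        _ ≤ 1 / 4 := two_pow_mul_exp_le_quarter K
    linarith
  -- (4) not good ⇒ bad ≥ 1, pointwise
  have hbad_nonneg : ∀ 𝒢, 0 ≤ bad 𝒢 := fun 𝒢 => by
    rw [hbad_def]; dsimp only
    exact add_nonneg (by split_ifs <;> norm_num) (sum_nonneg fun S _ => by split_ifs <;> norm_num)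
  have hgood_of : ∀ 𝒢 ∈ ℱ.powerset, bad 𝒢 < 1 → IsRelHomogeneous (4 * τ) 𝒜 𝒢 ∧ m ≤ 2 * #𝒢 := by
    intro 𝒢 h𝒢 hb1
    have h𝒢sub : 𝒢 ⊆ ℱ := mem_powerset.1 h𝒢
    have hind_nonneg : ∀ S ∈ 𝒮, (0 : ℝ) ≤ if 2 * lam S < #(supersets 𝒢 S) then (1 : ℝ) else 0 :=
      fun S _ => by split_ifs <;> norm_num
    have hsum_nonneg : (0 : ℝ) ≤ ∑ S ∈ 𝒮, (if 2 * lam S < #(supersets 𝒢 S) then (1 : ℝ) else 0) := sum_nonneg hind_nonneg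
    have hind0_nonneg : (0 : ℝ) ≤ if 2 * (#𝒢 : ℝ) < m then (1 : ℝ) else 0 := by split_ifs <;> norm_num
    have hcount : m ≤ 2 * #𝒢 := by
      by_contra h
      have : (if 2 * (#𝒢 : ℝ) < m then (1 : ℝ) else 0) = 1 := if_pos (not_le.1 h)
      have hb : (1 : ℝ) ≤ bad 𝒢 := by rw [hbad_def]; dsimp only; rw [this]; linarith
      linarith
    have hstar : ∀ S, (supersets 𝒜 S).Nonempty → (#(supersets 𝒢 S) : ℝ) ≤ 2 * lam S := by
      intro S hS
      have hS𝒮 : S ∈ 𝒮 := mem_filter.2 ⟨mem_univ _, hS⟩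
      by_contra h
      have hone : (if 2 * lam S < #(supersets 𝒢 S) then (1 : ℝ) else 0) = 1 := if_pos (not_le.1 h)
      have hle : (1 : ℝ) ≤ ∑ S ∈ 𝒮, (if 2 * lam S < #(supersets 𝒢 S) then (1 : ℝ) else 0) :=
        calc (1 : ℝ) = (if 2 * lam S < #(supersets 𝒢 S) then (1 : ℝ) else 0) := hone.symm
          _ ≤ ∑ S ∈ 𝒮, (if 2 * lam S < #(supersets 𝒢 S) then (1 : ℝ) else 0) := single_le_sum hind_nonneg hS𝒮
      have hb : (1 : ℝ) ≤ bad 𝒢 := by rw [hbad_def]; dsimp only; linarith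
      linarith
    refine ⟨fun S => ?_, hcount⟩
    rcases (supersets 𝒜 S).eq_empty_or_nonempty with hS | hS
    · have h𝒢S : supersets 𝒢 S = ∅ := subset_empty.1 (hS ▸ supersets_mono (h𝒢sub.trans hℱ𝒜) S)
      rw [h𝒢S, hS, card_empty, Nat.cast_zero, zero_mul, mul_zero, zero_mul]
    rcases S.eq_empty_or_nonempty with hS0 | hS0
    · subst hS0
      rw [supersets_emptyset, supersets_emptyset, card_empty, pow_zero, one_mul, mul_comm]
    have hs1 : 1 ≤ #S := card_pos.2 hS0
    have hk := hstar S hS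
    have hk' : (#(supersets 𝒢 S) : ℝ) * #𝒜 ≤ 2 * (τ ^ #S * #(supersets 𝒜 S) * m) := by
      have : 2 * lam S * #𝒜 = 2 * (τ ^ #S * #(supersets 𝒜 S) * m) := by rw [hlam_def]; dsimp only; field_simp
      rw [← this]; exact mul_le_mul_of_nonneg_right hk hApos.le
    have h4 : (4 : ℝ) * τ ^ #S ≤ (4 * τ) ^ #S := by
      rw [mul_pow]
      refine mul_le_mul_of_nonneg_right ?_ (pow_nonneg hτ _)
      calc (4 : ℝ) = 4 ^ 1 := (pow_one _).symm
        _ ≤ 4 ^ #S := pow_le_pow_right₀ (by norm_num) hs1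
    have hAS : (0 : ℝ) ≤ #(supersets 𝒜 S) := Nat.cast_nonneg _
    have h𝒢0 : (0 : ℝ) ≤ #𝒢 := Nat.cast_nonneg _
    calc (#(supersets 𝒢 S) : ℝ) * #𝒜 ≤ 2 * (τ ^ #S * #(supersets 𝒜 S) * m) := hk'
      _ ≤ 2 * (τ ^ #S * #(supersets 𝒜 S) * (2 * #𝒢)) :=
          mul_le_mul_of_nonneg_left (mul_le_mul_of_nonneg_left hcount (mul_nonneg (pow_nonneg hτ _) hAS)) (by norm_num)
      _ = (4 * τ ^ #S) * #(supersets 𝒜 S) * #𝒢 := by ring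
      _ ≤ (4 * τ) ^ #S * #(supersets 𝒜 S) * #𝒢 := mul_le_mul_of_nonneg_right (mul_le_mul_of_nonneg_right h4 hAS) h𝒢0
  -- (5) conclude: Σ_{good} P ≥ 1 − Σ P·bad ≥ 1/4
  have hpt : ∀ 𝒢 ∈ ℱ.powerset, P 𝒢 * (1 - bad 𝒢) ≤
      P 𝒢 * (if IsRelHomogeneous (4 * τ) 𝒜 𝒢 ∧ wmass y ℱ ≤ 2 * #𝒢 then (1 : ℝ) else 0) := by
    intro 𝒢 h𝒢
    refine mul_le_mul_of_nonneg_left ?_ (hP0 𝒢)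
    split_ifs with hg
    · linarith [hbad_nonneg 𝒢]
    · by_contra hcon
      rw [not_le] at hcon
      exact hg (hgood_of 𝒢 h𝒢 (by linarith))
  calc (1 : ℝ) / 4 ≤ ∑ 𝒢 ∈ ℱ.powerset, P 𝒢 * (1 - bad 𝒢) := by
        have : ∑ 𝒢 ∈ ℱ.powerset, P 𝒢 * (1 - bad 𝒢) = ∑ 𝒢 ∈ ℱ.powerset, P 𝒢 - ∑ 𝒢 ∈ ℱ.powerset, P 𝒢 * bad 𝒢 := by
          rw [← sum_sub_distrib]; exact sum_congr rfl fun 𝒢 _ => by ring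
        rw [this, hP1]; linarith
    _ ≤ _ := sum_le_sum hpt

end Summit.PneNP.PneNP.Theorems.ChebyshevTracialDesignBernoulliMarginals
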